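import Mathlib
import HarnessLib
import HarnessLib.Audit
import Summits.Langlands.Statement
import Literature.NumberTheory.Automorphic.CompletedCohomologyGL
import Literature.NumberTheory.Automorphic.LocalLanglandsGLProofs
import Literature.NumberTheory.Automorphic.LocalConstantsProofs
import HarnessLib.Audit.Status.Attr

/-!
Route: CMFreeCompletedClosure

# Route CMFreeCompletedClosure — close the torsion theory of completed cohomology ℓ-adically over
every totally complex field, then descend

It suffices to show, for every TOTALLY COMPLEX number field E, every n ≥ 1 and every prime ℓ, six
closure properties of the big ℓ-adic Hecke algebra of completed cohomology of GL_n over E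
(vocabulary `BigHeckeGLn.TameLevel`, `EigensystemOccurs`, `heckeFrobPoly`, `IsAssociatedFamily` of
`Literature.NumberTheory.Automorphic.CompletedCohomologyHeckeAlgebraGLn/CompletedCohomologyGL`):
(C1) every ℤ̄_ℓ-valued eigensystem occurring in completed cohomology mod ℓ^m carries a semisimple
Galois representation (TorsionGaloisRep); (C2) every L-algebraic cuspidal π occurs, through the
Hecke dictionary of its C-algebraic contragredient twist (Visibility); (C3) every irreducible
geometric ρ occurs (ProAutomorphy); (C4) an occurring irreducible geometric ρ is the Satake avatar
of a cuspidal L-algebraic π, given reciprocity (A) in ranks < n (DeRhamClassicality); (C5) the ρ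
attached to a cuspidal π is irreducible, de Rham at ℓ and satisfies local–global compatibility up to
Frobenius-semisimplification at every place, given reciprocity (B) in ranks < n
(AutomorphicPointCompatibility); (C6) semisimplified compatibility upgrades to full
`LocalGlobalCompatibleAt` with the monodromy operator, and ρ is unique up to conjugacy
(TemperedPurity); plus (S0) the reduction of the summit over an arbitrary F to totally complex
fields by quadratic ascent E = F·K and descent (TotallyComplexReduction). Realises the card
cm-free-completed-closure; X = S0 ∧ C1 ∧ … ∧ C6.
Lean: `TotallyComplexReduction ∧ TorsionGaloisRep ∧ Visibility ∧ ProAutomorphy ∧ DeRhamClassicality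
∧ AutomorphicPointCompatibility ∧ TemperedPurity`

## Assembly
Pure logic plus strong induction on n (certified in glue.lean, theorem `closes`, 0 sorry): apply S0;
fix E totally complex, R, and induct on n. Clause (A) at rank n: Visibility gives an occurring
eigensystem a matching π; TorsionGaloisRep gives a semisimple ρ associated with a; finiteness of
𝒰.bad turns association + the Hecke dictionary into Satake–Frobenius compatibility almost
everywhere; AutomorphicPointCompatibility (fed clause (B) in ranks < n from the induction
hypothesis) gives irreducibility, de Rham-ness and semisimplified compatibility; TemperedPurity
gives full local–global compatibility and uniqueness. Clause (B) at rank n: ProAutomorphy gives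
occurrence of ρ; DeRhamClassicality (fed clause (A) in ranks < n) gives a cuspidal L-algebraic π
Satake-compatible with ρ; irreducible ⇒ semisimple; AutomorphicPointCompatibility and TemperedPurity
again give `Corresponds`.

Rationale: WHY THIS LINE. Over a CM field the torsion theory of completed cohomology is the engine behind every
recent case of reciprocity for GL_n (arXiv:1306.2070 Thm 3 and Conj 2 p. 3; arXiv:1207.4224 Thm 1.1
and Conj A p. 2; arXiv:1609.06965 p. 2 and Thm 2; arXiv:1812.09999; arXiv:2301.10509); Gee–Newton
already ask (p. 2) whether the construction runs "for GL_n over a number field F" and note that the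
needed torsion conjectures are open exactly when F is not totally real or CM. This route takes the
ℓ-adic closure of that engine over an arbitrary TOTALLY COMPLEX field E as the thesis and makes the
CM hypothesis enter at ONE typed place, the residual crux TorsionGaloisRep (Scholze's Conjecture 2
mod ℓ^m), instead of everywhere; every other step is typed over the tree's completed-cohomology
vocabulary with no Shimura variety in its statement. The reduction S0 uses only quadratic base
change/descent (Arthur–Clozel) through E = F·K, so the open core is E totally complex non-CM;
irregular (limit of discrete series) π enter through torsion/congruence visibility (C2) rather than
characteristic-0 cohomology, the monodromy operator through tempered purity (C6) rather than limits.
Imported areas: p-adic Hodge theory and perfectoid torsion methods (C1), Calegari–Geraghty derived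
patching of completed homology (C3), locally analytic / eigenvariety classicality (C4,
arXiv:2008.07099, arXiv:1702.02192), Deligne–Serre congruences and local–global compatibility up to
semisimplification (C5, arXiv:2607.11763 Thm 1.2.1, arXiv:2311.13514), weight–monodromy/tempered
purity (C6, arXiv:math/0412357). What prior routes do not do: CMFern and NewtonPatching live over CM
fields and regular weight; BaseFieldAscent descends but has no engine above; none types visibility
of irregular π, classicality of de Rham points, or the N-upgrade; the negatives index (4 entries:
SplitPrimeInduction ×2, OrdinaryPrimeTransport, K3KugaSatakeDescent) concerns induction from split
primes, Rankin–Selberg pole counts and K3 descent, none of which this line uses.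

RANKED CRUXES. #2 Visibility (crux) — (C2) for E totally complex, n ≥ 1, every L-algebraic cuspidal
π of GL_n(𝔸_E), every ℓ and ι : ℚ̄_ℓ ≃ ℂ: some ℤ̄_ℓ-valued eigensystem a of the big Hecke algebra
occurs in completed cohomology at some tame level 𝒰 (mod every ℓ^m, `EigensystemOccurs`) and, at
every v ∉ 𝒰.bad, π is unramified with Satake parameter α_v and the Hecke polynomial of a at v equals
the arithmetic-Frobenius Satake polynomial `arithFrobPolyOfSatake ι q_v 1 α_v` (a = eigensystem of
the C-algebraic twist π^∨ ⊗ |det|^((n-1)/2)). Card item C2. [difficulty: open-problem] (why it might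
fail: irregular (limit-of-discrete-series) π need not be congruent mod ℓ^m to cohomological
eigensystems of bounded tame level for all m: weight-one type congruences (Deligne–Serre) are
unknown beyond GL_2 and holomorphic LDS, and completed cohomology of GL_n, n ≥ 3, may simply miss
them.) [arXiv:1306.2070, arXiv:1207.4224, arXiv:1204.6697, arXiv:1412.1533, arXiv:1009.0154]
#3 TorsionGaloisRep (crux) — (C1, RESIDUAL — Scholze's Conjecture 2 mod ℓ^m over totally complex
fields) for E totally complex, every n, ℓ, tame level 𝒰 and every ℤ̄_ℓ-valued big-Hecke eigensystem
a occurring in completed cohomology in some degree i: there is a semisimple framed ℓ-adic Galois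
representation ρ of G_E associated with a off 𝒰.bad (`IsAssociatedFamily`: unramified with Frobenius
characteristic polynomial = Hecke polynomial). Known for E CM (arXiv:1306.2070 Thm 3 + Cor 5.4.x);
open for E non-CM — the CM-free core. Card items C1 + S-lim. [difficulty: open-problem] (why it
might fail: for E totally complex non-CM no Hermitian space has Res GL_n/E as a Levi, so the only
construction of torsion Galois representations (boundary of U(n,n) Shimura varieties) is
unavailable; the statement is Ash's conjecture there and could fail only with reciprocity itself.)
[arXiv:1306.2070, arXiv:1207.4224, arXiv:1609.06965, arXiv:1812.09999]
#4 DeRhamClassicality (crux) — (C4) for E totally complex, n ≥ 1, reciprocity data R, assuming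
clause (A) of the summit in every rank n' < n over E: if a ℤ̄_ℓ-eigensystem a occurs in completed
cohomology at tame level 𝒰 and ρ is an irreducible framed ℓ-adic representation, geometric for R
(a.e. unramified, de Rham at ℓ) and associated with a off 𝒰.bad, then for every compact-level
witness hcpt there is an L-algebraic cuspidal π of GL_n(𝔸_E) whose Satake parameters match the
Frobenius characteristic polynomials of ρ at almost all places. Card item C4 (+ the cuspidality half
of S-ind). [deps: TorsionGaloisRep] [difficulty: open-problem] (why it might fail: classicality of
de Rham points of completed cohomology is known only for GL_2/ℚ (Emerton, Pan: weights 0,0 and k ≥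
2); for GL_n(E_v), E_v ≠ ℚ_p, there is no p-adic local Langlands, and an irregular de Rham point may
fail to be classical (no companion-form theory).) [arXiv:2008.07099, arXiv:2209.06366,
arXiv:1702.02192, arXiv:1609.06965]
#5 AutomorphicPointCompatibility (crux) — (C5) for E totally complex, n ≥ 1, reciprocity data R,
assuming clause (B) of the summit in every rank n' < n over E: if π is L-algebraic cuspidal on
GL_n(𝔸_E) and ρ is a semisimple framed ℓ-adic representation Satake–Frobenius compatible with π at
almost all places, then ρ is irreducible, de Rham at every v ∣ ℓ (Fontaine's D_pst on E_v), and at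
EVERY place v local–global compatibility holds up to Frobenius-semisimplification: the Weil–Deligne
representation of ρ|_(E_v) (Grothendieck recipe at v ∤ ℓ, Fontaine at v ∣ ℓ), transported along ι,
has the same characteristic polynomials on the Weil group as a representative of rec(π_v). Card
items C5 (+ the irreducibility half of S-ind via Jacquet–Shalika). [deps: TorsionGaloisRep,
Visibility] [difficulty: open-problem] (why it might fail: ℓ-adic limits of de Rham representations
need not be de Rham (arXiv:2607.11763 p. 5): for irregular π the interpolated ρ may fail de
Rham-ness at v ∣ ℓ, and semisimplified compatibility at v ∣ ℓ is known only for regular π over CM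
fields.) [arXiv:2607.11763, arXiv:2311.13514, arXiv:2301.10509, arXiv:1306.2070]
#6 ProAutomorphy (crux) — (C3) for E totally complex, n ≥ 1, reciprocity data R, every ℓ and every
irreducible framed ℓ-adic ρ of G_E that is geometric for R: the Frobenius eigensystem of ρ occurs in
completed cohomology — some ℤ̄_ℓ-eigensystem a occurs at some tame level 𝒰 and ρ is associated with
a off 𝒰.bad. Card item C3. [deps: TorsionGaloisRep] [difficulty: open-problem] (why it might fail:
big R = 𝕋 by Calegari–Geraghty/Gee–Newton patching needs residual occurrence (Serre-type conjecture,
open even for GL_2 over imaginary quadratic fields), a big residual image, and the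
codimension/vanishing conjectures; residually reducible or small-image ρ have no mechanism.)
[arXiv:1609.06965, arXiv:1207.4224, arXiv:1812.09999, arXiv:2301.10509]
#7 TemperedPurity (crux) — (C6) for E totally complex, n ≥ 1, R, an L-algebraic cuspidal π, an
irreducible framed ℓ-adic ρ Satake–Frobenius compatible with π almost everywhere and satisfying
semisimplified local–global compatibility at every place (the conclusion of C5): then full
`LocalGlobalCompatibleAt R ι π ρ v` holds at every v (the Frobenius-semisimplified Weil–Deligne
representation WITH its monodromy operator is rec(π_v)), and every ρ' corresponding to π is
conjugate to ρ. Mechanism: temperedness/purity pins N (Taylor–Yoshida), Chebotarev + Brauer–Nesbitt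
pins ρ. Card item C6 (+ uniqueness). [deps: AutomorphicPointCompatibility] [difficulty:
open-problem] (why it might fail: N is not closed under ℓ-adic limits (catalogued barrier): for
irregular π no purity/temperedness input is known (Ramanujan open; no motive), so the
semisimplification may carry several monodromy types compatible with all interpolated data.)
[arXiv:math/0412357, arXiv:2607.11763, arXiv:2301.10509]
#9 TotallyComplexReduction (support) — (S0) if both clauses of reciprocity hold for every totally
complex number field E, every reciprocity data on E, every n ≥ 1 and every compact-level witness,
then the summit `Langlands` holds for every number field F: existence of reciprocity data on F
(local Langlands for GL_n(F_v) + Fontaine's D_pst, constructions in the tree) and quadratic base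
change / descent along E = F·K for a suitable imaginary quadratic K (Arthur–Clozel), run inside the
strong induction on n. [difficulty: XL] [ArthurClozel1989, arXiv:1306.2070]

TWO-LAYER PLAN. Foreseen glued splits once a crux closes or stalls (none filed now):
TorsionGaloisRep ⇐ (continuous n-dimensional Galois determinant valued in the big Hecke algebra,
`Literature.NumberTheory.GaloisRepresentations.HeckeDeterminant`) → (Chenevier reconstruction of a
semisimple ρ from a determinant over ℤ̄_ℓ); Visibility ⇐ (regular-algebraic case via Franke/Borel +
Emerton's comparison) → (congruence limit for irregular π); TemperedPurity ⇐ (v ∤ ℓ) → (v ∣ ℓ) →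
(uniqueness via the landed Brauer–Nesbitt–Chebotarev theorem p119850); ProAutomorphy ⇐ (residual
occurrence mod 𝔪) → (big R = 𝕋 lifting).

KILL CRITERIA. A refutation of Visibility (an L-algebraic cuspidal π over a totally complex E whose
twisted eigensystem occurs in completed cohomology at no tame level — e.g. a GL_2 analogue over an
imaginary quadratic field of the even-Maass obstruction over ℚ) closes the route outright (close
--reason refuted:Visibility): completed cohomology is then the wrong avatar space. A refutation of
TemperedPurity or AutomorphicPointCompatibility as typed (a Weil-group charpoly/transport
mis-typing) forces a restatement, not a pivot. A disproof of TorsionGaloisRep would refute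
reciprocity itself. If CMFern closes GeometricFernCM/AutToGalCM over CM fields, this route is mooted
exactly on CM E and keeps its non-CM core.

NOT DECOMPOSED YET. The Hecke-algebra-valued determinant behind TorsionGaloisRep, the
residual-occurrence (Serre weight) half of ProAutomorphy, the split of TemperedPurity into v ∤ ℓ / v
∣ ℓ / uniqueness, the regular/irregular split of Visibility, and the isobaric (non-cuspidal)
intermediate of DeRhamClassicality are layer-2 children (see Two-layer plan); Jacquet–Shalika and
Arthur–Clozel enter only inside proofs of C4/C5/S0, never as items.

CHEAPEST FALSIFIER. The Hecke dictionary inside Visibility, checked on paper from the two tree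
definitions (`heckeFrobPoly n q a = X^n + Σ_i (-1)^i q^(i(i-1)/2) a_i X^(n-i)`,
`arithFrobPolyOfSatake ι q 1 α = ∏_(a ∈ α) (X - ι⁻¹(a⁻¹))`): the identity forces a_(v,i) =
ι⁻¹(q_v^(-i(i-1)/2) e_i(α_v⁻¹)), which is the T_(v,i)-eigensystem of the C-algebraic twist π^∨ ⊗
|det|^((n-1)/2) (Shimura: T_(v,i) ↦ q^(i(n-i)/2) e_i); for n = 2: X² - a₁X + q a₂ = (X - ι⁻¹α₁⁻¹)(X
- ι⁻¹α₂⁻¹) with a₁ = ι⁻¹(α₁⁻¹ + α₂⁻¹), a₂ = ι⁻¹(q⁻¹α₁⁻¹α₂⁻¹) ✓ by hand (not yet run in Lean). The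
cheapest kill is therefore: take a weight-2 Bianchi newform over ℚ(i) (regular, cohomological in H¹
of the Bianchi 3-fold), and verify in Lean that its twisted eigensystem is ℓ-integral and
`EigensystemOccurs` holds at its own tame level with exactly this polynomial identity; an
integrality or sign/normalisation mismatch would refute Visibility for trivial reasons, so a refuter
should run this first.

NUMBERS. l₀ = number of complex places of E times (n-1) + … (Borel–Wallach range [q₀, q₀+l₀])
governs the Calegari–Geraghty patching in ProAutomorphy (arXiv:1207.4224 p. 2: "we hope that the
methods … can be adapted to general l₀"; arXiv:1609.06965 Thm 1–2 conditional on vanishing outside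
[q₀, q₀+l₀] and the codimension conjecture).

DEFINITION REQUESTS. None at open: every item is typed over existing declarations
(`BigHeckeGLn.TameLevel.EigensystemOccurs`, `heckeFrobPoly`, `IsAssociatedFamily`, the summit API).
Wanted later (layer 2): a `TameLevel`-valued Galois determinant interface (exists:
`Literature.NumberTheory.GaloisRepresentations.HeckeDeterminant`).

Novelty: Searches (2026-08-17): lit search --hybrid "torsion cohomology locally symmetric Galois
representations totally real or CM p-adic interpolation" (8 book hits, none on point); lit papers
grep Scholze|Calegari|Caraiani|Hevesi (3 held: arXiv:2301.10509, arXiv:2311.13514,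
arXiv:2607.11763); lit read arXiv:1306.2070 (p. 3: Conj 1, Conj 2, Thm 3, irregular π remark),
arXiv:1207.4224 (p. 2 Conj A/Thm 1.1, p. 3 "difficult to construct Galois representations whenever
l₀ ≠ 0", p. 32 no solvable base change), arXiv:1609.06965 (p. 2 "for a general F these conjectures
are open", Thm 2 big R = 𝕋), arXiv:2607.11763 (Thm 1.2.1, Cor 1.2.2); lit galaxy search "completed
cohomology|torsion Galois representations|Calegari-Geraghty" --star all (17 rows;
[galaxy:panama:373455996321853] Coates–Kim volume with the Calegari–Emerton survey,
[galaxy:pdf:-8600971430654097580] Weinstein BAMS survey, [galaxy:pdf:-7206016738830806840] Venkatesh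
derived Hecke algebra); ledger negatives --problem Langlands (4, unrelated); route files CMFern,
BaseFieldAscent, BianchiDeligneSerre, NewtonPatching, PrimeSwitchSplit, EisensteinDegreeShift read.
Nearest prior art found: arXiv:1609.06965 (Gee–Newton: conditional big R = 𝕋 for completed homology
of PGL_n over a general number field, assuming torsion Galois representations with local–global
compatibility and vanishing/codimension conjectures) and arXiv:1207.4224 Conj A; in the tree, route
CMFern (GeometricFernCM/AutToGalCM over CM fields, regular weight).
Delta: the  [refs: 2301.10509, 2311.13514, 2607.11763, 1306.2070, 1207.4224, 1609.06965, paper:arxiv-1306.2070, paper:arxiv-1609.06965, paper:arxiv-2607.11763]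

Barriers (technique_class: completed-cohomology, torsion-galois-rep, CG-patching): - technique_class: completed-cohomology torsion-classes pseudorepresentation p-adic-limit
congruences p-adic-interpolation boundary-cohomology calegari-geraghty-patching
quadratic-base-change
- Literature.Barriers.Langlands.ShimuraVarietyRealizationBarrier: it does not, for TorsionGaloisRep
over non-CM totally complex E (no Hermitian space with Levi Res GL_n/E;
[corpus:paper:arxiv-1306.2070 p.3-4] boundary of U(n,n)/Sp_2n, CM/totally real only;
[corpus:paper:arxiv-1609.06965 p.2] "for a general F these conjectures are open") — declared
RESIDUAL; every other crux lives in completed cohomology of GL_n/E itself and names no Shimura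
variety.
- Literature.Barriers.Langlands.ShimuraVarietyRealizationBarrierNarrow: inside, sharper than the
previous line — a totally complex non-CM E has aiDefect d = [E : E⁺] ≥ 3 (d = 2 would make E CM), so
`not_oddPairing_aiDefect_of_three_le` makes every Shimura realisation after induction to E⁺
degenerate: TorsionGaloisRep over such E requires-beating-barrier ⇒ declared RESIDUAL (CM case =
arXiv:1306.2070 Conj B, Scholze); Visibility/ProAutomorphy/DeRhamClassicality never realise π in a
Shimura variety (they live in H̃ of the GL_n/E tower), so it does not quantify over them.
- Literature.Barriers.Langlands.NonRegularWeightBarrier: evaded in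
Visibility/DeRhamClassicality/AutomorphicPointCompatibility by replacing characteristic-0 cohomology
with occurrence mod ℓ^m at growing level, the mechanism by which weight-one forms are seen
p-adically; the bet

sub-problem: Langlands · status: draft · opened planner-type-f53dacf04e-0 2026-08-17T16:31:55Z · rev 1 · ledger route-Langlands-CMFreeCompletedClosure
GENERATED by the gate from the ledger (D-0016/17). Provers cite these decls: `theorem foo : Summit.Langlands.Langlands.Theses.CMFreeCompletedClosure.<Decl> := …` in Summits/Langlands/Langlands/Theorems/<Name>.lean.
-/

namespace Summit.Langlands.Langlands.Theses.CMFreeCompletedClosure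

open scoped BigOperators Topology Manifold Classical MeasureTheory ProbabilityTheory Matrix InnerProductSpace ComplexConjugate ContinuousMap
open Filter Set Function TopologicalSpace MeasureTheory

attribute [summit_statement] _root_.Langlands

/-- item stmt-Langlands-18470 · crux · rank 2 · open · by planner
why it might fail: irregular (limit-of-discrete-series) π need not be congruent mod ℓ^m to cohomological eigensystems of bounded tame level for all m: weight-one type congruences (Deligne–Serre) are unknown beyond GL_2 and holomorphic LDS, and completed cohomology of GL_n, n ≥ 3, may simply miss them.
sources: arXiv:1306.2070, arXiv:1207.4224, arXiv:1204.6697, arXiv:1412.1533, arXiv:1009.0154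
[crux] (C2) for E totally complex, n ≥ 1, every L-algebraic cuspidal π of GL_n(𝔸_E), every ℓ and ι :
ℚ̄_ℓ ≃ ℂ: some ℤ̄_ℓ-valued eigensystem a of the big Hecke algebra occurs in completed cohomology at
some tame level 𝒰 (mod every ℓ^m, `EigensystemOccurs`) and, at every v ∉ 𝒰.bad, π is unramified with
Satake parameter α_v and the Hecke polynomial of a at v equals the arithmetic-Frobenius Satake
polynomial `arithFrobPolyOfSatake ι q_v 1 α_v` (a = eigensystem of the C-algebraic twist π^∨ ⊗
|det|^((n-1)/2)). Card item C2. [difficulty: open-problem] -/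
@[route_item "route-Langlands-CMFreeCompletedClosure", crux]
def Visibility : Prop :=
  ∀ (E : Type) [Field E] [NumberField E], NumberField.IsTotallyComplex E → ∀ (n : ℕ), 0 < n → ∀ (hcpt : Literature.NumberTheory.Automorphic.isCompact_glFiniteIntegralLevel n E) (π : Literature.NumberTheory.Automorphic.CuspidalAutomorphicRepData n E hcpt), π.1.IsLAlgebraic → ∀ (ℓ : ℕ) [Fact ℓ.Prime] (ι : PadicAlgCl ℓ ≃+* ℂ), ∃ (𝒰 : Literature.NumberTheory.Automorphic.BigHeckeGLn.TameLevel n E ℓ) (i : ℕ) (a : IsDedekindDomain.HeightOneSpectrum (NumberField.RingOfIntegers E) → ℕ → (Valued.v : Valuation (PadicAlgCl ℓ) NNReal).valuationSubring), 𝒰.EigensystemOccurs (Valued.v : Valuation (PadicAlgCl ℓ) NNReal).valuationSubring a i ∧ ∀ v ∉ 𝒰.bad, ∃ α : Multiset ℂ, π.1.HasSatakeParamAt v α ∧ Literature.NumberTheory.Automorphic.BigHeckeGLn.heckeFrobPoly n (Ideal.absNorm v.asIdeal) (fun j => ((a v j : (Valued.v : Valuation (PadicAlgCl ℓ) NNReal).valuationSubring)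 : PadicAlgCl ℓ)) = Literature.NumberTheory.Automorphic.arithFrobPolyOfSatake ι v.residueCard 1 α

/-- item stmt-Langlands-18471 · crux · rank 3 · open · by planner
why it might fail: for E totally complex non-CM no Hermitian space has Res GL_n/E as a Levi, so the only construction of torsion Galois representations (boundary of U(n,n) Shimura varieties) is unavailable; the statement is Ash's conjecture there and could fail only with reciprocity itself.
sources: arXiv:1306.2070, arXiv:1207.4224, arXiv:1609.06965, arXiv:1812.09999
[crux] (C1, RESIDUAL — Scholze's Conjecture 2 mod ℓ^m over totally complex fields) for E totally
complex, every n, ℓ, tame level 𝒰 and every ℤ̄_ℓ-valued big-Hecke eigensystem a occurring in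
completed cohomology in some degree i: there is a semisimple framed ℓ-adic Galois representation ρ
of G_E associated with a off 𝒰.bad (`IsAssociatedFamily`: unramified with Frobenius characteristic
polynomial = Hecke polynomial). Known for E CM (arXiv:1306.2070 Thm 3 + Cor 5.4.x); open for E
non-CM — the CM-free core. Card items C1 + S-lim. [difficulty: open-problem] -/
@[route_item "route-Langlands-CMFreeCompletedClosure", crux]
def TorsionGaloisRep : Prop :=
  ∀ (E : Type) [Field E] [NumberField E], NumberField.IsTotallyComplex E → ∀ (n ℓ : ℕ) [Fact ℓ.Prime] (𝒰 : Literature.NumberTheory.Automorphic.BigHeckeGLn.TameLevel n E ℓ) (i : ℕ) (a : IsDedekindDomain.HeightOneSpectrum (NumberField.RingOfIntegers E) → ℕ → (Valued.v : Valuation (PadicAlgCl ℓ) NNReal).valuationSubring), 𝒰.EigensystemOccurs (Valued.v : Valuation (PadicAlgCl ℓ) NNReal).valuationSubring a i → ∃ ρ : Literature.NumberTheory.GaloisRepresentations.FramedGaloisRep E (PadicAlgCl ℓ) n, ρ.toGaloisRep.IsSemisimple ∧ Literature.NumberTheory.Automorphic.BigHeckeGLn.IsAssociatedFamily n 𝒰.bad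 (fun v j => ((a v j : (Valued.v : Valuation (PadicAlgCl ℓ) NNReal).valuationSubring) : PadicAlgCl ℓ)) ρ

/-- item stmt-Langlands-18472 · crux · rank 4 · open · by planner
why it might fail: classicality of de Rham points of completed cohomology is known only for GL_2/ℚ (Emerton, Pan: weights 0,0 and k ≥ 2); for GL_n(E_v), E_v ≠ ℚ_p, there is no p-adic local Langlands, and an irregular de Rham point may fail to be classical (no companion-form theory).
sources: arXiv:2008.07099, arXiv:2209.06366, arXiv:1702.02192, arXiv:1609.06965
[crux] (C4) for E totally complex, n ≥ 1, reciprocity data R, assuming clause (A) of the summit in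
every rank n' < n over E: if a ℤ̄_ℓ-eigensystem a occurs in completed cohomology at tame level 𝒰 and
ρ is an irreducible framed ℓ-adic representation, geometric for R (a.e. unramified, de Rham at ℓ)
and associated with a off 𝒰.bad, then for every compact-level witness hcpt there is an L-algebraic
cuspidal π of GL_n(𝔸_E) whose Satake parameters match the Frobenius characteristic polynomials of ρ
at almost all places. Card item C4 (+ the cuspidality half of S-ind). [deps: TorsionGaloisRep]
[difficulty: open-problem] -/
@[route_item "route-Langlands-CMFreeCompletedClosure", crux]
def DeRhamClassicality : Prop :=
  ∀ (E : Type) [Field E] [NumberField E], NumberField.IsTotallyComplex E → ∀ (n : ℕ), 0 < n → ∀ (R : Summit.Langlands.ReciprocityData E), (∀ n' < n, 0 < n' → ∀ hcpt' : Literature.NumberTheory.Automorphic.isCompact_glFiniteIntegralLevel n' E, Summit.Langlands.AutomorphicToGalois n' R hcpt') → ∀ (ℓ : ℕ) [Fact ℓ.Prime] (ι : PadicAlgCl ℓ ≃+* ℂ) (𝒰 : Literature.NumberTheory.Automorphic.BigHeckeGLn.TameLevel n E ℓ) (i : ℕ) (a : IsDedekindDomain.HeightOneSpectrum (NumberField.RingOfIntegers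 E) → ℕ → (Valued.v : Valuation (PadicAlgCl ℓ) NNReal).valuationSubring), 𝒰.EigensystemOccurs (Valued.v : Valuation (PadicAlgCl ℓ) NNReal).valuationSubring a i → ∀ ρ : Literature.NumberTheory.GaloisRepresentations.FramedGaloisRep E (PadicAlgCl ℓ) n, ρ.toGaloisRep.IsIrreducible → Summit.Langlands.IsGeometricFramed R ρ → Literature.NumberTheory.Automorphic.BigHeckeGLn.IsAssociatedFamily n 𝒰.bad (fun v j => ((a v j : (Valued.v : Valuation (PadicAlgCl ℓ) NNReal).valuationSubring) : PadicAlgCl ℓ)) ρ → ∀ hcpt : Literature.NumberTheory.Automorphic.isCompact_glFiniteIntegralLevel n E, ∃ π : Literature.NumberTheory.Automorphic.CuspidalAutomorphicRepData n E hcpt, π.1.IsLAlgebraic ∧ ∀ᶠ v : IsDedekindDomain.HeightOneSpectrum (NumberField.RingOfIntegers E) in Filter.cofinite, Summit.Langlands.SatakeFrobCompatibleAt ι π.1 ρ v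

/-- item stmt-Langlands-18473 · crux · rank 5 · open · by planner
why it might fail: ℓ-adic limits of de Rham representations need not be de Rham (arXiv:2607.11763 p. 5): for irregular π the interpolated ρ may fail de Rham-ness at v ∣ ℓ, and semisimplified compatibility at v ∣ ℓ is known only for regular π over CM fields.
sources: arXiv:2607.11763, arXiv:2311.13514, arXiv:2301.10509, arXiv:1306.2070
[crux] (C5) for E totally complex, n ≥ 1, reciprocity data R, assuming clause (B) of the summit in
every rank n' < n over E: if π is L-algebraic cuspidal on GL_n(𝔸_E) and ρ is a semisimple framed
ℓ-adic representation Satake–Frobenius compatible with π at almost all places, then ρ is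
irreducible, de Rham at every v ∣ ℓ (Fontaine's D_pst on E_v), and at EVERY place v local–global
compatibility holds up to Frobenius-semisimplification: the Weil–Deligne representation of ρ|_(E_v)
(Grothendieck recipe at v ∤ ℓ, Fontaine at v ∣ ℓ), transported along ι, has the same characteristic
polynomials on the Weil group as a representative of rec(π_v). Card items C5 (+ the irreducibility
half of S-ind via Jacquet–Shalika). [deps: TorsionGaloisRep, Visibility] [difficulty: open-problem] -/
@[route_item "route-Langlands-CMFreeCompletedClosure", crux]
def AutomorphicPointCompatibility : Prop :=
  ∀ (E : Type) [Field E] [NumberField E], NumberField.IsTotallyComplex E → ∀ (n : ℕ), 0 < n → ∀ (R : Summit.Langlands.ReciprocityData E), (∀ n' < n, 0 < n' → ∀ hcpt' : Literature.NumberTheory.Automorphic.isCompact_glFiniteIntegralLevel n' E, Summit.Langlands.GaloisToAutomorphic n' R hcpt') → ∀ (hcpt : Literature.NumberTheory.Automorphic.isCompact_glFiniteIntegralLevel n E) (π : Literature.NumberTheory.Automorphic.CuspidalAutomorphicRepData n E hcpt), π.1.IsLAlgebraic → ∀ (ℓ : ℕ) [Fact ℓ.Prime] (ι : PadicAlgCl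 ℓ ≃+* ℂ) (ρ : Literature.NumberTheory.GaloisRepresentations.FramedGaloisRep E (PadicAlgCl ℓ) n), ρ.toGaloisRep.IsSemisimple → (∀ᶠ v : IsDedekindDomain.HeightOneSpectrum (NumberField.RingOfIntegers E) in Filter.cofinite, Summit.Langlands.SatakeFrobCompatibleAt ι π.1 ρ v) → ρ.toGaloisRep.IsIrreducible ∧ (∀ (v : IsDedekindDomain.HeightOneSpectrum (NumberField.RingOfIntegers E)) (hv : ((ℓ : ℕ) : NumberField.RingOfIntegers E) ∈ v.asIdeal), (R.pst ℓ v hv).IsDeRhamFramed (ρ.toLocal v)) ∧ ∀ v : IsDedekindDomain.HeightOneSpectrum (NumberField.RingOfIntegers E), ∃ (πv : Literature.NumberTheory.Automorphic.SmoothIrrep (Matrix.GeneralLinearGroup (Fin n) (v.adicCompletion E))) (r : Literature.NumberTheory.GaloisRepresentations.WeilDeligneRep (v.adicCompletion E) (PadicAlgCl ℓ) (Fin n → PadicAlgCl ℓ)) (rℂ r₀ : Literature.NumberTheory.GaloisRepresentations.WeilDeligneRep (v.adicCompletion E) ℂ (Fin n → ℂ)) (h₀ : r₀.IsFrobSemisimple),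 π.1.HasLocalComponentAt v πv.ρ ∧ (((ℓ : ℕ) : NumberField.RingOfIntegers E) ∉ v.asIdeal → Literature.NumberTheory.GaloisRepresentations.IsWeilDeligneOfLadic (ρ.toLocal v).toWeilGroupHom r) ∧ (∀ hv : ((ℓ : ℕ) : NumberField.RingOfIntegers E) ∈ v.asIdeal, (R.pst ℓ v hv).IsWeilDeligneOf (ρ.toLocal v) r) ∧ r.IsTransportAlong (ι : PadicAlgCl ℓ →+* ℂ) rℂ ∧ Quotient.mk (Literature.NumberTheory.Automorphic.frobSemisimpleWDSetoid (v.adicCompletion E) n) ⟨r₀, h₀⟩ = (R.llc v).recGL n (Literature.NumberTheory.Automorphic.IrrClass.mk πv) ∧ ∀ w : Literature.NumberTheory.GaloisRepresentations.WeilGroup (v.adicCompletion E), (LinearMap.toMatrix' (rℂ.ρ w)).charpoly = (LinearMap.toMatrix' (r₀.ρ w)).charpoly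

/-- item stmt-Langlands-18474 · crux · rank 6 · open · by planner
why it might fail: big R = 𝕋 by Calegari–Geraghty/Gee–Newton patching needs residual occurrence (Serre-type conjecture, open even for GL_2 over imaginary quadratic fields), a big residual image, and the codimension/vanishing conjectures; residually reducible or small-image ρ have no mechanism.
sources: arXiv:1609.06965, arXiv:1207.4224, arXiv:1812.09999, arXiv:2301.10509
[crux] (C3) for E totally complex, n ≥ 1, reciprocity data R, every ℓ and every irreducible framed
ℓ-adic ρ of G_E that is geometric for R: the Frobenius eigensystem of ρ occurs in completed
cohomology — some ℤ̄_ℓ-eigensystem a occurs at some tame level 𝒰 and ρ is associated with a off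
𝒰.bad. Card item C3. [deps: TorsionGaloisRep] [difficulty: open-problem] -/
@[route_item "route-Langlands-CMFreeCompletedClosure", crux]
def ProAutomorphy : Prop :=
  ∀ (E : Type) [Field E] [NumberField E], NumberField.IsTotallyComplex E → ∀ (n : ℕ), 0 < n → ∀ (R : Summit.Langlands.ReciprocityData E) (ℓ : ℕ) [Fact ℓ.Prime] (ρ : Literature.NumberTheory.GaloisRepresentations.FramedGaloisRep E (PadicAlgCl ℓ) n), ρ.toGaloisRep.IsIrreducible → Summit.Langlands.IsGeometricFramed R ρ → ∃ (𝒰 : Literature.NumberTheory.Automorphic.BigHeckeGLn.TameLevel n E ℓ) (i : ℕ) (a : IsDedekindDomain.HeightOneSpectrum (NumberField.RingOfIntegers E) → ℕ → (Valued.v : Valuation (PadicAlgCl ℓ) NNReal).valuationSubring), 𝒰.EigensystemOccurs (Valued.v : Valuation (PadicAlgCl ℓ) NNReal).valuationSubring a i ∧ Literature.NumberTheory.Automorphic.BigHeckeGLn.IsAssociatedFamily n 𝒰.bad (fun v j => ((a v j : (Valued.v : Valuation (PadicAlgCl ℓ) NNReal).valuationSubring) : PadicAlgCl ℓ)) ρ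

/-- item stmt-Langlands-18475 · crux · rank 7 · open · by planner
why it might fail: N is not closed under ℓ-adic limits (catalogued barrier): for irregular π no purity/temperedness input is known (Ramanujan open; no motive), so the semisimplification may carry several monodromy types compatible with all interpolated data.
sources: arXiv:math/0412357, arXiv:2607.11763, arXiv:2301.10509
[crux] (C6) for E totally complex, n ≥ 1, R, an L-algebraic cuspidal π, an irreducible framed ℓ-adic
ρ Satake–Frobenius compatible with π almost everywhere and satisfying semisimplified local–global
compatibility at every place (the conclusion of C5): then full `LocalGlobalCompatibleAt R ι π ρ v`
holds at every v (the Frobenius-semisimplified Weil–Deligne representation WITH its monodromy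
operator is rec(π_v)), and every ρ' corresponding to π is conjugate to ρ. Mechanism:
temperedness/purity pins N (Taylor–Yoshida), Chebotarev + Brauer–Nesbitt pins ρ. Card item C6 (+
uniqueness). [deps: AutomorphicPointCompatibility] [difficulty: open-problem] -/
@[route_item "route-Langlands-CMFreeCompletedClosure", crux]
def TemperedPurity : Prop :=
  ∀ (E : Type) [Field E] [NumberField E], NumberField.IsTotallyComplex E → ∀ (n : ℕ), 0 < n → ∀ (R : Summit.Langlands.ReciprocityData E) (hcpt : Literature.NumberTheory.Automorphic.isCompact_glFiniteIntegralLevel n E) (π : Literature.NumberTheory.Automorphic.CuspidalAutomorphicRepData n E hcpt), π.1.IsLAlgebraic → ∀ (ℓ : ℕ) [Fact ℓ.Prime] (ι : PadicAlgCl ℓ ≃+* ℂ) (ρ : Literature.NumberTheory.GaloisRepresentations.FramedGaloisRep E (PadicAlgCl ℓ) n), ρ.toGaloisRep.IsIrreducible → (∀ᶠ v : IsDedekindDomain.HeightOneSpectrum (NumberField.RingOfIntegers E) in Filter.cofinite, Summit.Langlands.SatakeFrobCompatibleAt ι π.1 ρ v) → (∀ v : IsDedekindDomain.HeightOneSpectrum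 (NumberField.RingOfIntegers E), ∃ (πv : Literature.NumberTheory.Automorphic.SmoothIrrep (Matrix.GeneralLinearGroup (Fin n) (v.adicCompletion E))) (r : Literature.NumberTheory.GaloisRepresentations.WeilDeligneRep (v.adicCompletion E) (PadicAlgCl ℓ) (Fin n → PadicAlgCl ℓ)) (rℂ r₀ : Literature.NumberTheory.GaloisRepresentations.WeilDeligneRep (v.adicCompletion E) ℂ (Fin n → ℂ)) (h₀ : r₀.IsFrobSemisimple), π.1.HasLocalComponentAt v πv.ρ ∧ (((ℓ : ℕ) : NumberField.RingOfIntegers E) ∉ v.asIdeal → Literature.NumberTheory.GaloisRepresentations.IsWeilDeligneOfLadic (ρ.toLocal v).toWeilGroupHom r) ∧ (∀ hv : ((ℓ : ℕ) : NumberField.RingOfIntegers E) ∈ v.asIdeal, (R.pst ℓ v hv).IsWeilDeligneOf (ρ.toLocal v) r) ∧ r.IsTransportAlong (ι : PadicAlgCl ℓ →+* ℂ) rℂ ∧ Quotient.mk (Literature.NumberTheory.Automorphic.frobSemisimpleWDSetoid (v.adicCompletion E) n) ⟨r₀, h₀⟩ = (R.llc v).recGL n (Literature.NumberTheory.Automorphic.IrrClass.mk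 πv) ∧ ∀ w : Literature.NumberTheory.GaloisRepresentations.WeilGroup (v.adicCompletion E), (LinearMap.toMatrix' (rℂ.ρ w)).charpoly = (LinearMap.toMatrix' (r₀.ρ w)).charpoly) → (∀ v : IsDedekindDomain.HeightOneSpectrum (NumberField.RingOfIntegers E), Summit.Langlands.LocalGlobalCompatibleAt R ι π.1 ρ v) ∧ ∀ ρ' : Literature.NumberTheory.GaloisRepresentations.FramedGaloisRep E (PadicAlgCl ℓ) n, Summit.Langlands.Corresponds R ι π.1 ρ' → Summit.Langlands.IsConjugate ρ ρ'

/-- item stmt-Langlands-18476 · support · rank 9 · open · by planner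
sources: ArthurClozel1989, arXiv:1306.2070
[support] (S0) if both clauses of reciprocity hold for every totally complex number field E, every
reciprocity data on E, every n ≥ 1 and every compact-level witness, then the summit `Langlands`
holds for every number field F: existence of reciprocity data on F (local Langlands for GL_n(F_v) +
Fontaine's D_pst, constructions in the tree) and quadratic base change / descent along E = F·K for a
suitable imaginary quadratic K (Arthur–Clozel), run inside the strong induction on n. [difficulty:
XL] -/
@[route_item "route-Langlands-CMFreeCompletedClosure", crux]
def TotallyComplexReduction : Prop :=
  (∀ (E : Type) [Field E] [NumberField E], NumberField.IsTotallyComplex E → ∀ (R : Summit.Langlands.ReciprocityData E) (n : ℕ), 0 < n → ∀ hcpt : Literature.NumberTheory.Automorphic.isCompact_glFiniteIntegralLevel n E, Summit.Langlands.GlobalLanglandsCorrespondenceGLn n E R hcpt) → Langlands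

/-- item stmt-Langlands-18477 · assembly · rank 1 · closed · proved by Summit.Langlands.Langlands.Theorems.cMFreeCompletedClosure_assembly_proof (prover) · by planner
sources: arXiv:1306.2070, arXiv:1207.4224
[assembly] S0 → C1 → C2 → C3 → C4 → C5 → C6 → Langlands (the summit statement, root namespace). -/
@[route_item "route-Langlands-CMFreeCompletedClosure"]
def Assembly : Prop :=
  TotallyComplexReduction → TorsionGaloisRep → Visibility → ProAutomorphy → DeRhamClassicality → AutomorphicPointCompatibility → TemperedPurity → Langlands

-- `Assembly` holds: proved by `Summit.Langlands.Langlands.Theorems.cMFreeCompletedClosure_assembly_proof` (its module imports this route file, so no `_holds` link can be stated here).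

/-! D-0027 §2.1 — DECIDING THEOREM (planner-authored via `route open/edit --closes-file`; by planner-type-f53dacf04e-0 2026-08-17T16:31:55Z):
its hypotheses are this route's items and its conclusion the sub-problem Statement (glue_lint), and it elaborates with this file. -/

@[closes "route-Langlands-CMFreeCompletedClosure"] theorem closes (hS0 : TotallyComplexReduction) (h1 : TorsionGaloisRep) (h2 : Visibility)
    (h3 : ProAutomorphy) (h4 : DeRhamClassicality) (h5 : AutomorphicPointCompatibility)
    (h6 : TemperedPurity) : Langlands := by
  have asm : Assembly := by
    intro hS0 h1 h2 h3 h4 h5 h6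
    apply hS0
    intro E _ _ hE R n
    induction n using Nat.strong_induction_on with
    | _ n ih => ?_
    intro hn hcpt
    have ihA : ∀ n' < n, 0 < n' →
        ∀ hcpt' : Literature.NumberTheory.Automorphic.isCompact_glFiniteIntegralLevel n' E,
          Summit.Langlands.AutomorphicToGalois n' R hcpt' :=
      fun n' hn' hpos hcpt' => (ih n' hn' hpos hcpt').1
    have ihB : ∀ n' < n, 0 < n' →
        ∀ hcpt' : Literature.NumberTheory.Automorphic.isCompact_glFiniteIntegralLevel n' E,
          Summit.Langlands.GaloisToAutomorphic n' R hcpt' :=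
      fun n' hn' hpos hcpt' => (ih n' hn' hpos hcpt').2
    have hA : Summit.Langlands.AutomorphicToGalois n R hcpt := by
      intro π hπ ℓ _ ι
      obtain ⟨𝒰, i, a, hocc, hsat⟩ := h2 E hE n hn hcpt π hπ ℓ ι
      obtain ⟨ρ, hss, hassoc⟩ := h1 E hE n ℓ 𝒰 i a hocc
      have hsf : ∀ v ∉ 𝒰.bad, Summit.Langlands.SatakeFrobCompatibleAt ι π.1 ρ v := by
        intro v hv
        obtain ⟨α, hα, heq⟩ := hsat v hv
        obtain ⟨hur, hcp⟩ := hassoc v hv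
        exact ⟨α, hα, hur, heq ▸ hcp⟩
      have hev : ∀ᶠ v : IsDedekindDomain.HeightOneSpectrum (NumberField.RingOfIntegers E) in
          Filter.cofinite, Summit.Langlands.SatakeFrobCompatibleAt ι π.1 ρ v :=
        (Set.Finite.eventually_cofinite_notMem 𝒰.bad_finite).mono hsf
      obtain ⟨hirr, hdR, hss'⟩ := h5 E hE n hn R ihB hcpt π hπ ℓ ι ρ hss hev
      obtain ⟨hlgc, huniq⟩ := h6 E hE n hn R hcpt π hπ ℓ ι ρ hirr hev hss'
      exact ⟨ρ, hirr, ⟨hev.mono fun v hv => hv.choose_spec.2.1, hdR⟩, ⟨hev, hlgc⟩, huniq⟩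
    have hB : Summit.Langlands.GaloisToAutomorphic n R hcpt := by
      intro ℓ _ ι ρ hirr hgeo
      obtain ⟨𝒰, i, a, hocc, hassoc⟩ := h3 E hE n hn R ℓ ρ hirr hgeo
      obtain ⟨π, hπ, hev⟩ := h4 E hE n hn R ihA ℓ ι 𝒰 i a hocc ρ hirr hgeo hassoc hcpt
      have hss : ρ.toGaloisRep.IsSemisimple := by
        haveI := hirr
        change ComplementedLattice _
        infer_instance
      obtain ⟨-, -, hss'⟩ := h5 E hE n hn R ihB hcpt π hπ ℓ ι ρ hss hev
      obtain ⟨hlgc, -⟩ := h6 E hE n hn R hcpt π hπ ℓ ι ρ hirr hev hss'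
      exact ⟨π, hπ, hev, hlgc⟩
    exact ⟨hA, hB⟩
  exact asm hS0 h1 h2 h3 h4 h5 h6

end Summit.Langlands.Langlands.Theses.CMFreeCompletedClosure
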